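import Literature.NumberTheory.EllipticCurves.PAdicLFunctionQuadraticTwistCongruenceAtTwoPeriodProofs
import Literature.NumberTheory.EllipticCurves.PAdicLFunctionTameCongruenceAtTwoAutoProofs
import Literature.NumberTheory.EllipticCurves.PAdicLFunctionTameBirchTransformProofs
import HarnessLib

/-!
# Route `AlignedTransportAtTwo`, crux C1 `MainConjectureTransportAlignedAtTwo` (stmt-BirchSwinnertonDyer-22296), line `birth` — NEGATIVE
# twists, measure and transform level: from a Birch relation UP TO INTEGERS, `[x]⁺_g = c·(Σ_b χ(b)[x + b/m]⁺_f + k_x)` (`k_x ∈ ℤ`, the output of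
# the rhombic shortcut of `…NegTwistSymbol.lean` for an ODD quadratic twist), to the `2`-adic transform congruence
# `L₂(g, χ(2)α) ≡ C(c)·(1+T)^{−f_m}·L₂(f, m, α, 𝟙_m) (mod 2c·Λ)` — the `m`-DEPLETED plus `2`-adic `L`-function of `f` on the right

HONEST FRAMING (cell `bsd-f1-sign2`, lead seat `bsd-line-att-p1` g7). BSD is NOT proved; C1 is NOT closed. THEOREMS ONLY; nothing asserted;
`--supports stmt-BirchSwinnertonDyer-22296 --as helper`. Abstract in the pair `(f, g)` (weight-`2` forms; `f` a rational newform of ODD level `N`,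
`(m, 2N) = 1`, `α` a root of `X² − a₂X + 2` with `‖α⁻¹‖ ≤ 1`; `χ` a `ℚ`-valued character mod `m` with `χ(2)² = 1` and `χ(b)² = 1` on units):

* §1 `exists_msdMeasure_twist_eq_sum_msdMeasureTame_add` — measure level: `μ_{g,χ(2)α}(a + 2ⁿℤ₂) = c·Σ_b χ(b)·μ_{f,α,m}((a·m + 2ⁿℤ₂) × {b}) + c·e`,
  `‖e‖ ≤ 1` (the tree's `msdMeasure_twist_eq_sum_msdMeasureTame`, MTT §I.8–I.10, with the integer slack carried along; `α` `2`-adically bounded).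
* §2 `norm_weighted_sub_weighted_one_le_one` — the CHARACTER HALF on single values: `‖Σ_b χ(b)μ_b − Σ_b 𝟙_m(b)μ_b‖₂ ≤ 1` when `‖μ_b‖₂ ≤ 2`
  (`χ(b) − 1 ∈ {0, −2}` on units; Matsuno 2000 Lemma 3.2 at `p = 2` for the HALVED symbol); `norm_padicLRiemannSum_twist_sub_half_le` — the
  Riemann sums of `L₂(g, χ(2)α)` are, up to `2c·(unit ball)`, `2c` times the `η = 1` HALF of the translated `𝟙_m`-weighted tame Riemann sums
  of `f` (Δ-doubling `padicLRiemannSum_two` for the even measure of `g`; tame INT2-AUTO `‖μ_{f,α,m}‖ ≤ 2`, `norm_msdMeasureTame_two_le_two_auto`);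
  `translatedRiemannSumTame_one_two_eq` — Δ-doubling of the translated `𝟙_m`-weighted sum (`msdMeasureTame_neg`).
* Companion file `…NegTwistTransform.lean` §3 `exists_padicLFunction_twist_eq_add_two_mul` — passing to the limit:
  `L₂(g, χ(2)α) = C(c)·(1+T)^{−f_m}·L₂(f, m, α, 𝟙_m) + C(2c)·ι(E)` for some `E ∈ Λ = ℤ₂⟦T⟧`.

Why only the trivial character survives: for ODD `χ` the tree's `χ`-weighted plus tame transform `L₂(f, m, α, χ)` vanishes identically (the
integrand is odd under `x ↦ −x` on `ℤ_{2,m}^×`), so the comparison must be made on the `η = 1` half, where `χ ≡ 𝟙_m (mod 2)` on the halved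
symbols turns it into the depleted function. Downstream (`…NegTwistCongruence.lean`): the tree's depletion half
`exists_iwasawa_padicLFunctionTame_one_congr_two_auto` (`L₂(f,m,α,𝟙_m) ≡ u·L₂(f,α)·∏𝒫_ℓ`) gives the `d < 0` twin of the cell `bsd-2adic` congruence
`exists_iwasawa_twist_congr_two_and_sq`.

References: [MazurTateTeitelbaum1986Invent] §I.8, §I.10 (10.1), §I.13; [Matsuno2000] Lemmas 3.2–3.3 and proof of Thm. 3.1 (pp. 86–88).
-/

set_option autoImplicit false
set_option linter.dupNamespace false

noncomputable section

open scoped Classical MatrixGroups ModularForm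

open CongruenceSubgroup Filter Topology PowerSeries
open Literature.NumberTheory.EllipticCurves Literature.NumberTheory.EllipticCurves.ModularForms
  Literature.NumberTheory.EllipticCurves.GreenbergVatsal2000

namespace Summit.BirchSwinnertonDyer.BirchSwinnertonDyer.Theorems.AlignedTransportAtTwoNegTwistMeasure

/-! ## §1 Measure level: Birch's relation up to integers -/

section Measure

variable {N N' : ℕ} [NeZero N] [NeZero N'] (f : CuspForm (Gamma0 N) 2) (g : CuspForm (Gamma0 N') 2)
  {m : ℕ} [NeZero m]

omit [NeZero N] in
/-- The denominator of `j·a/2ⁿ` is prime to an odd `N`; private helper. [folklore] -/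
private theorem coprime_den_natCast_div_two_pow (h2N : ¬ 2 ∣ N) (j a n : ℕ) :
    Nat.Coprime ((j : ℚ) * ((a : ℚ) / (2 : ℚ) ^ n)).den N := by
  have h := Rat.den_dvd ((j * a : ℕ) : ℤ) ((2 : ℤ) ^ n)
  rw [Rat.divInt_eq_div] at h
  push_cast at h
  have e : (j : ℚ) * ((a : ℚ) / (2 : ℚ) ^ n) = (j : ℚ) * a / 2 ^ n := by ring
  rw [e]
  have h' : ((j : ℚ) * a / 2 ^ n).den ∣ 2 ^ n := by exact_mod_cast h
  exact Nat.Coprime.coprime_dvd_left h' (Nat.Coprime.pow_left n ((Nat.Prime.coprime_iff_not_dvd Nat.prime_two).mpr h2N))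

omit [NeZero N'] in
/-- **Birch's lemma at the level of the measures, UP TO INTEGERS.** Let `χ` be a `ℚ`-valued character mod `m`, `(m, 2) = 1`, `χ(2)² = 1`,
`c ∈ ℚ`, `α ∈ ℚ₂` with `‖α⁻¹‖ ≤ 1`, and assume `[x]⁺_g = c·(Σ_{b mod m} χ(b)[x + b/m]⁺_f + k_x)` with `k_x ∈ ℤ` for every `x` of denominator
prime to the odd level `N`. Then for every `n`, `a mod 2ⁿ`:
`μ_{g, χ(2)α}(a + 2ⁿℤ₂) = c·Σ_{b mod m} χ(b)·μ_{f,α,m}((a·m + 2ⁿℤ₂) × {b}) + c·e` with `‖e‖₂ ≤ 1` (`e = (χ(2)α)⁻ⁿk₁ − (χ(2)α)⁻ⁿ⁻¹k₂`). The tree's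
`msdMeasure_twist_eq_sum_msdMeasureTame` (exact relation) with the slack carried along.
[cite: MazurTateTeitelbaum1986Invent, §I.8–I.10 (pp. 10–13)] [cite: Matsuno2000, §2 (p. 84)] -/
theorem exists_msdMeasure_twist_eq_sum_msdMeasureTame_add (hm2 : m.Coprime 2) (h2N : ¬ 2 ∣ N) (χ : MulChar (ZMod m) ℚ)
    (hχ2 : χ (2 : ZMod m) ^ 2 = 1) {c : ℚ}
    (hBk : ∀ x : ℚ, Nat.Coprime x.den N →
      ∃ k : ℤ, ratPlusSymbol g x = c * (∑ b : ZMod m, χ b * ratPlusSymbol f (x + (b.val : ℚ) / m) + k))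
    {α : ℚ_[2]} (hα : ‖α⁻¹‖ ≤ 1) (n : ℕ) (a : ZMod (2 ^ n)) :
    ∃ e : ℚ_[2], ‖e‖ ≤ 1 ∧
      msdMeasure g (((χ (2 : ZMod m) : ℚ) : ℚ_[2]) * α) n a =
        (c : ℚ_[2]) * ∑ b : ZMod m, ((χ b : ℚ) : ℚ_[2]) * msdMeasureTame f m α n (a * (m : ZMod (2 ^ n))) b + (c : ℚ_[2]) * e := by
  have hχ21 : χ (2 : ZMod m) ≠ 0 := by
    intro h; rw [h] at hχ2; norm_num at hχ2
  have hinv : (((χ (2 : ZMod m) : ℚ) : ℚ_[2]))⁻¹ = ((χ (2 : ZMod m) : ℚ) : ℚ_[2]) := by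
    have h2 : ((χ (2 : ZMod m) : ℚ) : ℚ_[2]) * ((χ (2 : ZMod m) : ℚ) : ℚ_[2]) = 1 := by
      rw [← Rat.cast_mul, ← pow_two, hχ2, Rat.cast_one]
    exact inv_eq_of_mul_eq_one_right h2
  have hnormχ : ‖((χ (2 : ZMod m) : ℚ) : ℚ_[2])‖ = 1 := by
    have h2 : ‖((χ (2 : ZMod m) : ℚ) : ℚ_[2])‖ ^ 2 = 1 := by
      rw [← norm_pow, ← Rat.cast_pow, hχ2, Rat.cast_one, norm_one]
    exact (pow_eq_one_iff_of_nonneg (norm_nonneg _) two_ne_zero).mp h2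
  have hpow : ∀ n : ℕ, χ ((2 : ZMod m) ^ n) = χ (2 : ZMod m) ^ n := fun n ↦ map_pow χ _ n
  set α' : ℚ_[2] := ((χ (2 : ZMod m) : ℚ) : ℚ_[2]) * α with hα'
  have hα'i : ‖α'⁻¹‖ ≤ 1 := by
    rw [hα', mul_inv, norm_mul, hinv, hnormχ, one_mul]; exact hα
  -- the two points `x₁ = a/2ⁿ`, `x₂ = 2a/2ⁿ` and their integer slacks
  have hx₁ : Nat.Coprime (((a.val : ℚ) / (2 : ℚ) ^ n)).den N := by
    have h := coprime_den_natCast_div_two_pow h2N 1 a.val n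
    rwa [Nat.cast_one, one_mul] at h
  have hx₂ : Nat.Coprime (((2 : ℚ) * ((a.val : ℚ) / (2 : ℚ) ^ n))).den N := by
    have h := coprime_den_natCast_div_two_pow h2N 2 a.val n
    rwa [Nat.cast_ofNat] at h
  obtain ⟨k₁, hk₁⟩ := hBk _ hx₁
  obtain ⟨k₂, hk₂⟩ := hBk _ hx₂
  have hp2 : ((2 : ℕ) : ℚ) = (2 : ℚ) := by norm_num
  -- the two Birch sums over the tame fractions, cast to `ℚ₂`
  have key1 : (c : ℚ_[2]) * ∑ b : ZMod m, ((χ b : ℚ) : ℚ_[2]) *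
      (ratPlusSymbol f (tameFraction 2 m n (a * (m : ZMod (2 ^ n))) b) : ℚ_[2]) =
      ((χ (2 : ZMod m) : ℚ) : ℚ_[2]) ^ n *
        ((ratPlusSymbol g ((a.val : ℚ) / (2 : ℚ) ^ n) : ℚ_[2]) - (c : ℚ_[2]) * (k₁ : ℚ_[2])) := by
    have h := sum_mul_ratPlusSymbol_tameFraction_eq f hm2 χ n a
    simp only [Nat.cast_ofNat] at h
    rw [hpow] at h
    have h' := congrArg (fun q : ℚ ↦ ((c * q : ℚ) : ℚ_[2])) h
    have hk : (ratPlusSymbol g ((a.val : ℚ) / (2 : ℚ) ^ n) : ℚ_[2]) - (c : ℚ_[2]) * (k₁ : ℚ_[2]) =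
        ((c * ∑ b : ZMod m, χ b * ratPlusSymbol f ((a.val : ℚ) / (2 : ℚ) ^ n + (b.val : ℚ) / m) : ℚ) : ℚ_[2]) := by
      rw [hk₁]; push_cast; ring
    rw [hk]
    push_cast at h' ⊢
    rw [h']
    ring
  have key2 : (c : ℚ_[2]) * ∑ b : ZMod m, ((χ b : ℚ) : ℚ_[2]) *
      (ratPlusSymbol f ((2 : ℚ) * tameFraction 2 m n (a * (m : ZMod (2 ^ n))) b) : ℚ_[2]) =
      ((χ (2 : ZMod m) : ℚ) : ℚ_[2]) ^ (n + 1) *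
        ((ratPlusSymbol g ((2 : ℚ) * ((a.val : ℚ) / (2 : ℚ) ^ n)) : ℚ_[2]) - (c : ℚ_[2]) * (k₂ : ℚ_[2])) := by
    have h := sum_mul_ratPlusSymbol_prime_mul_tameFraction_eq f hm2 χ n a
    simp only [Nat.cast_ofNat] at h
    rw [hpow] at h
    have h1 : ∑ b : ZMod m, χ b * ratPlusSymbol f ((2 : ℚ) * tameFraction 2 m n (a * (m : ZMod (2 ^ n))) b) =
        χ (2 : ZMod m) ^ (n + 1) *
          ∑ b : ZMod m, χ b * ratPlusSymbol f ((2 : ℚ) * ((a.val : ℚ) / (2 : ℚ) ^ n) + (b.val : ℚ) / m) := by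
      have := congrArg (fun q ↦ χ (2 : ZMod m) * q) h
      rw [← mul_assoc, ← pow_two, hχ2, one_mul] at this
      rw [this]
      ring
    have h' := congrArg (fun q : ℚ ↦ ((c * q : ℚ) : ℚ_[2])) h1
    have hk : (ratPlusSymbol g ((2 : ℚ) * ((a.val : ℚ) / (2 : ℚ) ^ n)) : ℚ_[2]) - (c : ℚ_[2]) * (k₂ : ℚ_[2]) =
        ((c * ∑ b : ZMod m, χ b * ratPlusSymbol f ((2 : ℚ) * ((a.val : ℚ) / (2 : ℚ) ^ n) + (b.val : ℚ) / m) : ℚ) : ℚ_[2]) := by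
      rw [hk₂]; push_cast; ring
    rw [hk]
    push_cast at h' ⊢
    rw [h']
    ring
  refine ⟨α'⁻¹ ^ n * (k₁ : ℚ_[2]) - α'⁻¹ ^ (n + 1) * (k₂ : ℚ_[2]), ?_, ?_⟩
  · have hA : ‖α'⁻¹ ^ n * (k₁ : ℚ_[2])‖ ≤ 1 := by
      rw [norm_mul, norm_pow]
      exact mul_le_one₀ (pow_le_one₀ (norm_nonneg _) hα'i) (norm_nonneg _) (Padic.norm_int_le_one k₁)
    have hB : ‖α'⁻¹ ^ (n + 1) * (k₂ : ℚ_[2])‖ ≤ 1 := by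
      rw [norm_mul, norm_pow]
      exact mul_le_one₀ (pow_le_one₀ (norm_nonneg _) hα'i) (norm_nonneg _) (Padic.norm_int_le_one k₂)
    rw [sub_eq_add_neg]
    exact (Padic.nonarchimedean _ _).trans (max_le hA (by rw [norm_neg]; exact hB))
  -- expand the right-hand side
  have hRHS : (c : ℚ_[2]) * ∑ b : ZMod m, ((χ b : ℚ) : ℚ_[2]) * msdMeasureTame f m α n (a * (m : ZMod (2 ^ n))) b =
      α⁻¹ ^ n * ((c : ℚ_[2]) * ∑ b : ZMod m, ((χ b : ℚ) : ℚ_[2]) *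
        (ratPlusSymbol f (tameFraction 2 m n (a * (m : ZMod (2 ^ n))) b) : ℚ_[2])) -
      α⁻¹ ^ (n + 1) * ((c : ℚ_[2]) * ∑ b : ZMod m, ((χ b : ℚ) : ℚ_[2]) *
        (ratPlusSymbol f ((2 : ℚ) * tameFraction 2 m n (a * (m : ZMod (2 ^ n))) b) : ℚ_[2])) := by
    simp only [msdMeasureTame, hp2, Finset.mul_sum, ← Finset.sum_sub_distrib]
    refine Finset.sum_congr rfl fun b _ ↦ ?_
    ring
  rw [hRHS, key1, key2]
  cases n with
  | zero =>
    have ha : a.val = 0 := by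
      have h1 : a.val < 2 ^ 0 := ZMod.val_lt a
      have h2 : 2 ^ 0 = 1 := rfl
      omega
    simp only [msdMeasure, ha, Nat.cast_zero, zero_div, mul_zero, pow_zero, one_mul, zero_add, pow_one, mul_inv, hinv, hα']
    ring
  | succ n =>
    have hx : (2 : ℚ) * ((a.val : ℚ) / (2 : ℚ) ^ (n + 1)) = (a.val : ℚ) / (2 : ℚ) ^ n := by
      rw [pow_succ (2 : ℚ) n]; field_simp
    have hp2' : ((2 : ℕ) : ℚ) = (2 : ℚ) := by norm_num
    simp only [msdMeasure, hp2', hx, mul_inv, inv_pow, hinv, hα']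
    ring

end Measure

/-! ## §2 The character half on single values and on the `η = 1` half of the Riemann sums -/

section Half

variable {N N' : ℕ} [NeZero N] [NeZero N'] (f : CuspForm (Gamma0 N) 2) (g : CuspForm (Gamma0 N') 2)
  {m : ℕ} [NeZero m]

/-- `‖2‖₂ = 1/2`; private helper. [folklore] -/
private theorem norm_two_two : ‖(2 : ℚ_[2])‖ = (2 : ℝ)⁻¹ := by
  have h := Padic.norm_p (p := 2)
  simpa using h

/-- **The character half on single values (Matsuno's Lemma 3.2 at `p = 2` for the HALVED symbols).** For a `ℚ`-valued character `χ` mod `m`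
with `χ(b)² = 1` on units and values `μ_b ∈ ℚ₂` with `‖μ_b‖ ≤ 2`: `‖Σ_b χ(b)μ_b − Σ_b 𝟙_m(b)μ_b‖₂ ≤ 1` (`χ(b) − 𝟙_m(b) ∈ {0, −2}` on units,
both vanish off units). [cite: Matsuno2000, Lemma 3.2 (p. 87)] -/
theorem norm_weighted_sub_weighted_one_le_one (χ : MulChar (ZMod m) ℚ) (hχv : ∀ b : ZMod m, IsUnit b → χ b ^ 2 = 1)
    (μ : ZMod m → ℚ_[2]) (hμ : ∀ b, ‖μ b‖ ≤ 2) :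
    ‖∑ b : ZMod m, ((χ b : ℚ) : ℚ_[2]) * μ b - ∑ b : ZMod m, (1 : DirichletCharacter ℚ_[2] m) b * μ b‖ ≤ 1 := by
  rw [← Finset.sum_sub_distrib]
  refine IsUltrametricDist.norm_sum_le_of_forall_le_of_nonneg zero_le_one fun b _ ↦ ?_
  rw [← sub_mul, norm_mul]
  by_cases hb : IsUnit b
  · obtain ⟨u, rfl⟩ := hb
    rw [MulChar.one_apply_coe]
    rcases sq_eq_one_iff.mp (hχv _ u.isUnit) with h | h
    · rw [h, Rat.cast_one, sub_self, norm_zero, zero_mul]; exact zero_le_one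
    · rw [h, Rat.cast_neg, Rat.cast_one, show (-1 : ℚ_[2]) - 1 = -2 by norm_num, norm_neg, norm_two_two]
      calc (2 : ℝ)⁻¹ * ‖μ (u : ZMod m)‖ ≤ 2⁻¹ * 2 := by gcongr; exact hμ _
        _ = 1 := by norm_num
  · rw [χ.map_nonunit hb, MulChar.map_nonunit _ hb, Rat.cast_zero, sub_self, norm_zero, zero_mul]
    exact zero_le_one

/-- **The Riemann sums of the twist vs the `η = 1` HALF of the translated depleted tame sums.** Under the hypotheses of §1 with `f` a
newform of odd level `N` with real coefficients, `(m, N) = 1`, `α` a root of `X² − a₂X + 2` with `‖α⁻¹‖ ≤ 1` (so `‖μ_{f,α,m}‖₂ ≤ 2`,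
`norm_msdMeasureTame_two_le_two_auto`) and `χ(b)² = 1` on units: for every `k, n`,
`‖R_g(k,n) − 2c·Σ_{s mod 2ⁿ} ν_𝟙(m·5ˢ + 2ⁿ⁺²ℤ₂)·C(s,k)‖₂ ≤ ‖2c‖₂`, where `R_g(k,n) = padicLRiemannSum g (χ(2)α) k n` and
`ν_𝟙(y) = Σ_b 𝟙_m(b)·μ_{f,α,m}(y × {b})` (`R_g = 2·Σ_s μ_g(5ˢ)C(s,k)` by the Δ-doubling `padicLRiemannSum_two`; §1 termwise; character half §2).
[cite: MazurTateTeitelbaum1986Invent, §I.13 (p = 2: Δ = {±1}, γ = 5)] [cite: Matsuno2000, Lemmas 3.2–3.3 (pp. 87–88)] -/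
theorem norm_padicLRiemannSum_twist_sub_half_le (hf : IsNewform0 f) (hreal : ∀ n, (cuspCoeff f n).im = 0) (h2N : ¬ 2 ∣ N)
    (hm2 : m.Coprime 2) (hmN : m.Coprime N) {a₂ : ℤ} (ha₂ : cuspCoeff f 2 = a₂) {α : ℚ_[2]} (hα : ‖α⁻¹‖ ≤ 1)
    (hroot : α ^ 2 - a₂ * α + 2 = 0) (χ : MulChar (ZMod m) ℚ) (hχ2 : χ (2 : ZMod m) ^ 2 = 1)
    (hχv : ∀ b : ZMod m, IsUnit b → χ b ^ 2 = 1) {c : ℚ}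
    (hBk : ∀ x : ℚ, Nat.Coprime x.den N →
      ∃ k : ℤ, ratPlusSymbol g x = c * (∑ b : ZMod m, χ b * ratPlusSymbol f (x + (b.val : ℚ) / m) + k))
    (k n : ℕ) :
    ‖padicLRiemannSum g (((χ (2 : ZMod m) : ℚ) : ℚ_[2]) * α) k n -
      2 * (c : ℚ_[2]) * ∑ s : ZMod (2 ^ n), (∑ b : ZMod m, (1 : DirichletCharacter ℚ_[2] m) b *
        msdMeasureTame f m α (n + 2) ((cyclotomicGenerator 2 : ZMod (2 ^ (n + 2))) ^ s.val * (m : ZMod (2 ^ (n + 2)))) b) *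
        (s.val.choose k : ℚ_[2])‖ ≤ ‖(2 * c : ℚ_[2])‖ := by
  have hμ := norm_msdMeasureTame_two_le_two_auto (m := m) hf hreal h2N ha₂ hα hroot hmN
  -- termwise: §1 and the character half
  have hterm : ∀ s : ZMod (2 ^ n), ∃ e : ℚ_[2], ‖e‖ ≤ 1 ∧
      msdMeasure g (((χ (2 : ZMod m) : ℚ) : ℚ_[2]) * α) (n + 2) ((cyclotomicGenerator 2 : ZMod (2 ^ (n + 2))) ^ s.val) =
        (c : ℚ_[2]) * ∑ b : ZMod m, (1 : DirichletCharacter ℚ_[2] m) b *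
          msdMeasureTame f m α (n + 2) ((cyclotomicGenerator 2 : ZMod (2 ^ (n + 2))) ^ s.val * (m : ZMod (2 ^ (n + 2)))) b +
        (c : ℚ_[2]) * e := by
    intro s
    obtain ⟨e, he, hμg⟩ := exists_msdMeasure_twist_eq_sum_msdMeasureTame_add f g hm2 h2N χ hχ2 hBk hα (n + 2)
      ((cyclotomicGenerator 2 : ZMod (2 ^ (n + 2))) ^ s.val)
    set D : ℚ_[2] := ∑ b : ZMod m, ((χ b : ℚ) : ℚ_[2]) *
        msdMeasureTame f m α (n + 2) ((cyclotomicGenerator 2 : ZMod (2 ^ (n + 2))) ^ s.val * (m : ZMod (2 ^ (n + 2)))) b -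
      ∑ b : ZMod m, (1 : DirichletCharacter ℚ_[2] m) b *
        msdMeasureTame f m α (n + 2) ((cyclotomicGenerator 2 : ZMod (2 ^ (n + 2))) ^ s.val * (m : ZMod (2 ^ (n + 2)))) b with hD
    have hDn : ‖D‖ ≤ 1 := norm_weighted_sub_weighted_one_le_one χ hχv _ fun b ↦ hμ _ _ b
    refine ⟨D + e, (Padic.nonarchimedean _ _).trans (max_le hDn he), ?_⟩
    rw [hμg, hD]
    ring
  choose e he hμg using hterm
  rw [padicLRiemannSum_two, Finset.sum_congr rfl fun s _ ↦ by rw [hμg s]]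
  have hsplit : 2 * ∑ s : ZMod (2 ^ n), ((c : ℚ_[2]) * ∑ b : ZMod m, (1 : DirichletCharacter ℚ_[2] m) b *
        msdMeasureTame f m α (n + 2) ((cyclotomicGenerator 2 : ZMod (2 ^ (n + 2))) ^ s.val * (m : ZMod (2 ^ (n + 2)))) b +
        (c : ℚ_[2]) * e s) * (s.val.choose k : ℚ_[2]) -
      2 * (c : ℚ_[2]) * ∑ s : ZMod (2 ^ n), (∑ b : ZMod m, (1 : DirichletCharacter ℚ_[2] m) b *
        msdMeasureTame f m α (n + 2) ((cyclotomicGenerator 2 : ZMod (2 ^ (n + 2))) ^ s.val * (m : ZMod (2 ^ (n + 2)))) b) *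
        (s.val.choose k : ℚ_[2]) =
      (2 * c : ℚ_[2]) * ∑ s : ZMod (2 ^ n), e s * (s.val.choose k : ℚ_[2]) := by
    rw [Finset.mul_sum, Finset.mul_sum, Finset.mul_sum, ← Finset.sum_sub_distrib]
    refine Finset.sum_congr rfl fun s _ ↦ ?_
    ring
  rw [hsplit, norm_mul]
  refine mul_le_of_le_one_right (norm_nonneg _) ?_
  refine IsUltrametricDist.norm_sum_le_of_forall_le_of_nonneg zero_le_one fun s _ ↦ ?_
  rw [norm_mul]
  have hnat : ‖((s.val.choose k : ℕ) : ℚ_[2])‖ ≤ 1 := by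
    simpa using Padic.norm_int_le_one (p := 2) (s.val.choose k : ℤ)
  exact mul_le_one₀ (he s) (norm_nonneg _) hnat

/-- The `2`-adic roots of unity of order dividing `2` are `±1`; private helper (as in the tree's tame files). [folklore] -/
private theorem coe_rootsOfUnity_two_eq_one_or (ξ : rootsOfUnity 2 ℤ_[2]) :
    ((ξ : ℤ_[2]ˣ) : ℤ_[2]) = 1 ∨ ((ξ : ℤ_[2]ˣ) : ℤ_[2]) = -1 := by
  have h := ξ.2
  rw [mem_rootsOfUnity] at h
  have h' : (((ξ : ℤ_[2]ˣ) : ℤ_[2])) ^ 2 = 1 := by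
    rw [← Units.val_pow_eq_pow_val, h, Units.val_one]
  exact sq_eq_one_iff.mp h'

/-- **Δ-doubling of the TRANSLATED `𝟙_m`-weighted tame Riemann sum at `p = 2`**: with Teichmüller data `ω(m)·5^{f_m} = m` at every finite
level (`hc`), `Σ_{η=±1} Σ_s ν_𝟙((ω(m)5^{f_m})·(η5ˢ))·C(s,k) = 2·Σ_s ν_𝟙(5ˢ·m)·C(s,k)` — the `η = −1` half equals the `η = 1` half after
`b ↦ −b` (`msdMeasureTame_neg`, `𝟙_m(−b) = 𝟙_m(b)`). [cite: MazurTateTeitelbaum1986Invent, §I.13 (p = 2: Δ = {±1}, γ = 5)] -/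
theorem translatedRiemannSumTame_one_two_eq (hm2 : m.Coprime 2) (α : ℚ_[2])
    {teich : rootsOfUnity (torsionOrder 2) ℤ_[2]} {e : ℤ_[2]}
    (hc : ∀ n : ℕ, PadicInt.toZModPow (n + cyclotomicExponent 2) ((teich : ℤ_[2]ˣ) : ℤ_[2]) *
        (cyclotomicGenerator 2 : ZMod (2 ^ (n + cyclotomicExponent 2))) ^ (PadicInt.toZModPow n e).val =
          (m : ZMod (2 ^ (n + cyclotomicExponent 2)))) (k n : ℕ) :
    (∑ᶠ zz : rootsOfUnity (torsionOrder 2) ℤ_[2], ∑ s : ZMod (2 ^ n),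
        (fun (n : ℕ) (a : ZMod (2 ^ n)) ↦
            ∑ b : ZMod m, (1 : DirichletCharacter ℚ_[2] m) b * msdMeasureTame f m α n a b)
          (n + cyclotomicExponent 2)
          ((PadicInt.toZModPow (n + cyclotomicExponent 2) ((teich : ℤ_[2]ˣ) : ℤ_[2]) *
              (cyclotomicGenerator 2 : ZMod (2 ^ (n + cyclotomicExponent 2))) ^ (PadicInt.toZModPow n e).val) *
            (PadicInt.toZModPow (n + cyclotomicExponent 2) ((zz : ℤ_[2]ˣ) : ℤ_[2]) *
              (cyclotomicGenerator 2 : ZMod (2 ^ (n + cyclotomicExponent 2))) ^ s.val)) *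
          ((s.val.choose k : ℕ) : ℚ_[2])) =
      2 * ∑ s : ZMod (2 ^ n), (∑ b : ZMod m, (1 : DirichletCharacter ℚ_[2] m) b *
        msdMeasureTame f m α (n + 2) ((cyclotomicGenerator 2 : ZMod (2 ^ (n + 2))) ^ s.val * (m : ZMod (2 ^ (n + 2)))) b) *
        (s.val.choose k : ℚ_[2]) := by
  classical
  -- the summand as a function of the Teichmüller representative (level `n + 2`)
  set G : ℤ_[2] → ℚ_[2] := fun u ↦ ∑ s : ZMod (2 ^ n), (∑ b : ZMod m, (1 : DirichletCharacter ℚ_[2] m) b *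
    msdMeasureTame f m α (n + 2) ((m : ZMod (2 ^ (n + 2))) * (PadicInt.toZModPow (n + 2) u *
        (cyclotomicGenerator 2 : ZMod (2 ^ (n + 2))) ^ s.val)) b) * (s.val.choose k : ℚ_[2]) with hG
  have hG1 : G 1 = ∑ s : ZMod (2 ^ n), (∑ b : ZMod m, (1 : DirichletCharacter ℚ_[2] m) b *
      msdMeasureTame f m α (n + 2) ((cyclotomicGenerator 2 : ZMod (2 ^ (n + 2))) ^ s.val * (m : ZMod (2 ^ (n + 2)))) b) *
        (s.val.choose k : ℚ_[2]) := by
    simp only [hG, map_one, one_mul]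
    refine Finset.sum_congr rfl fun s _ ↦ ?_
    rw [mul_comm (m : ZMod (2 ^ (n + 2)))]
  have hGneg : G (-1) = G 1 := by
    simp only [hG, map_neg, map_one, neg_one_mul, one_mul]
    refine Finset.sum_congr rfl fun s _ ↦ ?_
    congr 1
    refine Fintype.sum_equiv (Equiv.neg (ZMod m)) _ _ fun b ↦ ?_
    rw [Equiv.neg_apply, show (1 : DirichletCharacter ℚ_[2] m) (-b) = (1 : DirichletCharacter ℚ_[2] m) b by
      rw [← neg_one_mul, map_mul, MulChar.one_apply isUnit_one.neg, one_mul], mul_neg,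
      ← msdMeasureTame_neg f hm2 α (n + 2) _ (-b), neg_neg]
  -- the torsion group at `2` is `{1, ζ}` with `ζ = -1`
  have hζmem : (-1 : ℤ_[2]ˣ) ∈ rootsOfUnity 2 ℤ_[2] := by
    rw [mem_rootsOfUnity]; norm_num
  set ζ : rootsOfUnity 2 ℤ_[2] := ⟨-1, hζmem⟩ with hζ
  have hne : (1 : rootsOfUnity 2 ℤ_[2]) ≠ ζ := by
    intro h
    have h' : (((1 : rootsOfUnity 2 ℤ_[2]) : ℤ_[2]ˣ) : ℤ_[2]) = ((ζ : ℤ_[2]ˣ) : ℤ_[2]) := by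
      rw [h]
    rw [hζ] at h'
    simp only [OneMemClass.coe_one, Units.val_one, Units.val_neg] at h'
    have h2 : (2 : ℤ_[2]) = 0 := by linear_combination h'
    exact two_ne_zero h2
  haveI : Fintype (rootsOfUnity 2 ℤ_[2]) := Fintype.ofFinite _
  have huniv : (Finset.univ : Finset (rootsOfUnity 2 ℤ_[2])) = {1, ζ} := by
    ext ξ
    simp only [Finset.mem_univ, Finset.mem_insert, Finset.mem_singleton, true_iff]
    rcases coe_rootsOfUnity_two_eq_one_or ξ with h | h
    · left
      exact Subtype.ext (Units.ext (by simpa using h))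
    · right
      exact Subtype.ext (Units.ext (by rw [hζ]; simpa using h))
  -- the translated sum as `Σ_ξ G ξ`
  have hRS : (∑ᶠ zz : rootsOfUnity (torsionOrder 2) ℤ_[2], ∑ s : ZMod (2 ^ n),
        (fun (n : ℕ) (a : ZMod (2 ^ n)) ↦
            ∑ b : ZMod m, (1 : DirichletCharacter ℚ_[2] m) b * msdMeasureTame f m α n a b)
          (n + cyclotomicExponent 2)
          ((PadicInt.toZModPow (n + cyclotomicExponent 2) ((teich : ℤ_[2]ˣ) : ℤ_[2]) *
              (cyclotomicGenerator 2 : ZMod (2 ^ (n + cyclotomicExponent 2))) ^ (PadicInt.toZModPow n e).val) *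
            (PadicInt.toZModPow (n + cyclotomicExponent 2) ((zz : ℤ_[2]ˣ) : ℤ_[2]) *
              (cyclotomicGenerator 2 : ZMod (2 ^ (n + cyclotomicExponent 2))) ^ s.val)) *
          ((s.val.choose k : ℕ) : ℚ_[2])) =
      ∑ᶠ ξ : rootsOfUnity (torsionOrder 2) ℤ_[2], G ((ξ : ℤ_[2]ˣ) : ℤ_[2]) := by
    refine finsum_congr fun ξ ↦ ?_
    rw [hc n]
    rfl
  rw [hRS, torsionOrder_two, finsum_eq_sum_of_fintype, huniv, Finset.sum_pair hne]
  simp only [OneMemClass.coe_one, Units.val_one, hζ, Units.val_neg]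
  rw [hGneg, hG1, two_mul]

end Half

end Summit.BirchSwinnertonDyer.BirchSwinnertonDyer.Theorems.AlignedTransportAtTwoNegTwistMeasure

end
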